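import Summits.CriticalPhenomena.PercolationContinuityZ3.Theorems.PercNearOneGluingNoHeavyLowerTailKnQuestion8CoefficientwiseGluing
import Summits.CriticalPhenomena.PercolationContinuityZ3.Theorems.PercNearOneGluingNoHeavyLowerTailDualBHKBlock
import HarnessLib

/-!
# THEOREM SP (c): the coefficientwise first rung is stable under hanging a DECORATION at a vertex

Support file (`--supports stmt-CriticalPhenomena-4575`, closed), prover `prim-lf-2` (gen 26).  No definitions, no named facts, no sorries; standard axioms.
Memo `prim-lf-2/CW-MARTINGALE-gen25.md` §8 (THEOREM SP (c) and its proof); bookkeeping `…CoefficientwiseGluing.lean`; companion `…CoefficientwiseSeries.lean`.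

The class `𝒞` (as in the companion): `(E; x, z) ∈ 𝒞` iff for all monotone `f, g : Set V → ℝ`
  `0 ≤ Σ_{s ⊆ E : z ∉ C_x(s), z ∉ C_x(E∖s)} (f(C_x s) − f(C_x(E∖s)))·(g(C_x s) − g(C_x(E∖s)))`   (`C_x(s) = openCluster (ends '' s) x`).

* `Coefficientwise.cwpa_decoration` — **THEOREM SP (c)**: if `E, D` are disjoint edge sets whose edges can only share the vertex `u`, the terminals `x, z` meet
  `D` only at `u` (if at all), and `(E; x, z) ∈ 𝒞`, then `(E ∪ D; x, z) ∈ 𝒞` — an arbitrary finite multigraph `D` may be hung at any single vertex.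
Proof (memo §8 (c)).  With `R = C_u(t)`, `R̄ = C_u(D∖t)` the two clusters of `u` inside the decoration, the clusters glue as `K' = K ∪ [u∈K]R`,
`K̄' = K̄ ∪ [u∈K̄]R̄` (`mem_openCluster_union_glue`) and the wall is unchanged.  Writing `f_W(X) = f(X ∪ [u∈X]W)`, the summand for `(s,t)` plus the summand for
`(s, D∖t)` equals, identically,
  `(f_R K − f_R K̄)(g_R̄ K − g_R̄ K̄) + (f_R̄ K − f_R̄ K̄)(g_R K − g_R K̄)` + `(f_R K − f_R̄ K)(g_R K − g_R̄ K) + (f_R K̄ − f_R̄ K̄)(g_R K̄ − g_R̄ K̄)`;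
summed over the wall event the first part is `T'(E)[f_R, g_R̄] + T'(E)[f_R̄, g_R] ≥ 0` (hypothesis), and the second part summed over `t ⊆ D` is two two-colouring
Harris sums on `D` (`harris_twoColouring_powerset`).  Hence `2·T'(E ∪ D) ≥ 0`.
[cite: KozmaNitzan2024, Questions 8–9 (§5.5 p. 36) (context: first rung of the coefficientwise programme for Question 8)]
-/

namespace Summit.CriticalPhenomena.PercolationContinuityZ3.Theorems

open Finset Literature.Probability.Percolation

namespace Coefficientwise

variable {ι V : Type*} [Fintype ι] [DecidableEq ι]

open Classical in
/-- **THEOREM SP (c) — decorations** (memo `prim-lf-2/CW-MARTINGALE-gen25.md` §8).  Let `E, D ⊆ ι` be disjoint edge sets of a finite multigraph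
`ends : ι → Sym2 V` such that an `E`-edge and a `D`-edge can only share the vertex `u`, and such that `x` and `z` lie on `D`-edges only if they equal `u`.
If `(E; x, z)` satisfies the coefficientwise first rung (for all monotone `φ, ψ`), then so does `(E ∪ D; x, z)`:
`0 ≤ Σ_{r ⊆ E∪D : no monochromatic x–z path} (f(C_x r) − f(C_x((E∪D)∖r)))(g(C_x r) − g(C_x((E∪D)∖r)))` for all monotone `f, g`.
[cite: KozmaNitzan2024, Questions 8–9 (§5.5 p. 36) (context)] -/
theorem cwpa_decoration (ends : ι → Sym2 V) {E D : Finset ι} (hED : Disjoint E D) {x z u : V}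
    (hsep : ∀ e ∈ E, ∀ e' ∈ D, ∀ w : V, w ∈ ends e → w ∈ ends e' → w = u)
    (hx : ∀ e ∈ D, x ∈ ends e → x = u) (hz : ∀ e ∈ D, z ∈ ends e → z = u)
    (h : ∀ φ ψ : Set V → ℝ, Monotone φ → Monotone ψ →
      0 ≤ ∑ s ∈ E.powerset.filter (fun s : Finset ι => z ∉ openCluster (ends '' (↑s : Set ι)) x ∧
            z ∉ openCluster (ends '' (↑(E \ s) : Set ι)) x),
        (φ (openCluster (ends '' (↑s : Set ι)) x) - φ (openCluster (ends '' (↑(E \ s) : Set ι)) x)) *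
          (ψ (openCluster (ends '' (↑s : Set ι)) x) - ψ (openCluster (ends '' (↑(E \ s) : Set ι)) x)))
    (f g : Set V → ℝ) (hf : Monotone f) (hg : Monotone g) :
    0 ≤ ∑ r ∈ (E ∪ D).powerset.filter (fun r : Finset ι => z ∉ openCluster (ends '' (↑r : Set ι)) x ∧
          z ∉ openCluster (ends '' (↑((E ∪ D) \ r) : Set ι)) x),
      (f (openCluster (ends '' (↑r : Set ι)) x) - f (openCluster (ends '' (↑((E ∪ D) \ r) : Set ι)) x)) *
        (g (openCluster (ends '' (↑r : Set ι)) x) - g (openCluster (ends '' (↑((E ∪ D) \ r) : Set ι)) x)) := by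
  -- notation: red clusters of `x` and of `u`, and the gluing operation at `u`
  set K : Finset ι → Set V := fun s => openCluster (ends '' (↑s : Set ι)) x with hK
  set R : Finset ι → Set V := fun t => openCluster (ends '' (↑t : Set ι)) u with hR
  set gl : Set V → Set V → Set V := fun X W => X ∪ {y | u ∈ X ∧ y ∈ W} with hgl
  change 0 ≤ ∑ r ∈ (E ∪ D).powerset.filter (fun r => z ∉ K r ∧ z ∉ K ((E ∪ D) \ r)),
      (f (K r) - f (K ((E ∪ D) \ r))) * (g (K r) - g (K ((E ∪ D) \ r)))
  have h' : ∀ φ ψ : Set V → ℝ, Monotone φ → Monotone ψ →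
      0 ≤ ∑ s ∈ E.powerset.filter (fun s => z ∉ K s ∧ z ∉ K (E \ s)),
        (φ (K s) - φ (K (E \ s))) * (ψ (K s) - ψ (K (E \ s))) := h
  -- basic facts
  have hRmono : ∀ {s t : Finset ι}, s ⊆ t → R s ⊆ R t := fun hst => openCluster_image_mono ends hst u
  have mem_gl : ∀ (X W : Set V) (y : V), y ∈ gl X W ↔ y ∈ X ∨ (u ∈ X ∧ y ∈ W) := fun X W y => by
    simp only [hgl, Set.mem_union, Set.mem_setOf_eq]
  have gl_mono_left : ∀ {X X' : Set V} (W : Set V), X ⊆ X' → gl X W ⊆ gl X' W := by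
    intro X X' W hXX' y hy
    rw [mem_gl] at hy ⊢
    rcases hy with hy | ⟨hu, hy⟩
    · exact Or.inl (hXX' hy)
    · exact Or.inr ⟨hXX' hu, hy⟩
  have gl_mono_right : ∀ (X : Set V) {W W' : Set V}, W ⊆ W' → gl X W ⊆ gl X W' := by
    intro X W W' hWW' y hy
    rw [mem_gl] at hy ⊢
    rcases hy with hy | ⟨hu, hy⟩
    · exact Or.inl hy
    · exact Or.inr ⟨hu, hWW' hy⟩
  -- `z` meets the decoration only at `u`, so the wall does not see the decoration
  have hzR : ∀ t : Finset ι, t ⊆ D → z ∈ R t → z = u := by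
    intro t ht hzt
    by_contra hzu
    obtain ⟨e, he, hze⟩ := exists_edge_of_mem_openCluster ends hzt hzu
    exact hzu (hz e (ht he) hze)
  have z_gl : ∀ (X : Set V) (t : Finset ι), t ⊆ D → (z ∈ gl X (R t) ↔ z ∈ X) := by
    intro X t ht
    rw [mem_gl]
    constructor
    · rintro (h1 | ⟨hu, h2⟩)
      · exact h1
      · rw [hzR t ht h2]; exact hu
    · exact Or.inl
  -- cluster decomposition under gluing at `u`
  have decomp : ∀ s t : Finset ι, s ⊆ E → t ⊆ D → K (s ∪ t) = gl (K s) (R t) := by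
    intro s t hs ht
    ext y
    rw [mem_gl]
    exact mem_openCluster_union_glue ends (fun e he e' he' w hw hw' => hsep e (hs he) e' (ht he') w hw hw')
      (fun e he hxe => hx e (ht he) hxe) y
  -- the glued summand
  set P : Finset ι → Finset ι → ℝ := fun s t =>
    (f (gl (K s) (R t)) - f (gl (K (E \ s)) (R (D \ t)))) * (g (gl (K s) (R t)) - g (gl (K (E \ s)) (R (D \ t)))) with hP
  simp only [Finset.sum_filter]
  rw [DualBHK.sum_powerset_union hED, Finset.sum_comm]
  have hsummand : ∀ t ∈ D.powerset, ∀ s ∈ E.powerset,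
      (if z ∉ K (s ∪ t) ∧ z ∉ K ((E ∪ D) \ (s ∪ t))
        then (f (K (s ∪ t)) - f (K ((E ∪ D) \ (s ∪ t)))) * (g (K (s ∪ t)) - g (K ((E ∪ D) \ (s ∪ t)))) else 0)
      = (if z ∉ K s ∧ z ∉ K (E \ s) then P s t else 0) := by
    intro t ht s hs
    have hs' := Finset.mem_powerset.mp hs
    have ht' := Finset.mem_powerset.mp ht
    have hK1 : K (s ∪ t) = gl (K s) (R t) := decomp s t hs' ht'
    have hKc : K ((E ∪ D) \ (s ∪ t)) = gl (K (E \ s)) (R (D \ t)) := by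
      rw [union_sdiff_union_of_subset hED hs' ht']
      exact decomp (E \ s) (D \ t) Finset.sdiff_subset Finset.sdiff_subset
    have hcond : (z ∉ K (s ∪ t) ∧ z ∉ K ((E ∪ D) \ (s ∪ t))) ↔ (z ∉ K s ∧ z ∉ K (E \ s)) := by
      rw [hK1, hKc]
      exact and_congr (not_congr (z_gl _ _ ht')) (not_congr (z_gl _ _ Finset.sdiff_subset))
    by_cases hc : z ∉ K (s ∪ t) ∧ z ∉ K ((E ∪ D) \ (s ∪ t))
    · rw [if_pos hc, if_pos (hcond.mp hc), hK1, hKc]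
    · rw [if_neg hc, if_neg (fun h => hc (hcond.mpr h))]
  rw [Finset.sum_congr rfl fun t ht => Finset.sum_congr rfl fun s hs => hsummand t ht s hs]
  simp only [← Finset.sum_filter]
  -- the wall event on `E`
  set S : Finset (Finset ι) := E.powerset.filter (fun s => z ∉ K s ∧ z ∉ K (E \ s)) with hS
  change 0 ≤ ∑ t ∈ D.powerset, ∑ s ∈ S, P s t
  -- the two parts of the symmetrised summand
  set Y : Finset ι → Finset ι → ℝ := fun s t =>
    (f (gl (K s) (R t)) - f (gl (K (E \ s)) (R t))) * (g (gl (K s) (R (D \ t))) - g (gl (K (E \ s)) (R (D \ t)))) +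
      (f (gl (K s) (R (D \ t))) - f (gl (K (E \ s)) (R (D \ t)))) * (g (gl (K s) (R t)) - g (gl (K (E \ s)) (R t))) with hY
  set Z : Finset ι → Finset ι → ℝ := fun s t =>
    (f (gl (K s) (R t)) - f (gl (K s) (R (D \ t)))) * (g (gl (K s) (R t)) - g (gl (K s) (R (D \ t)))) +
      (f (gl (K (E \ s)) (R t)) - f (gl (K (E \ s)) (R (D \ t)))) * (g (gl (K (E \ s)) (R t)) - g (gl (K (E \ s)) (R (D \ t)))) with hZ
  -- part Y: two instances of the hypothesis, with the sections `X ↦ f(X ∪ [u∈X]W)`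
  have hYnonneg : ∀ t : Finset ι, 0 ≤ ∑ s ∈ S, Y s t := by
    intro t
    have m1 : ∀ (φ : Set V → ℝ), Monotone φ → ∀ W : Set V, Monotone (fun X => φ (gl X W)) :=
      fun φ hφ W X X' hXX' => hφ (gl_mono_left W hXX')
    have hA := h' (fun X => f (gl X (R t))) (fun X => g (gl X (R (D \ t)))) (m1 f hf _) (m1 g hg _)
    have hB := h' (fun X => f (gl X (R (D \ t)))) (fun X => g (gl X (R t))) (m1 f hf _) (m1 g hg _)
    have : ∑ s ∈ S, Y s t = (∑ s ∈ S, (f (gl (K s) (R t)) - f (gl (K (E \ s)) (R t))) *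
          (g (gl (K s) (R (D \ t))) - g (gl (K (E \ s)) (R (D \ t))))) +
        ∑ s ∈ S, (f (gl (K s) (R (D \ t))) - f (gl (K (E \ s)) (R (D \ t)))) *
          (g (gl (K s) (R t)) - g (gl (K (E \ s)) (R t))) := by
      rw [← Finset.sum_add_distrib]
    rw [this]
    exact add_nonneg hA hB
  -- part Z: two two-colouring Harris sums on the decoration
  have hZnonneg : ∀ s : Finset ι, 0 ≤ ∑ t ∈ D.powerset, Z s t := by
    intro s
    have m2 : ∀ (φ : Set V → ℝ), Monotone φ → ∀ X : Set V, Monotone (fun t : Finset ι => φ (gl X (R t))) :=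
      fun φ hφ X t t' htt' => hφ (gl_mono_right X (hRmono htt'))
    have hA := harris_twoColouring_powerset D (fun t => f (gl (K s) (R t))) (fun t => g (gl (K s) (R t))) (m2 f hf _) (m2 g hg _)
    have hB := harris_twoColouring_powerset D (fun t => f (gl (K (E \ s)) (R t))) (fun t => g (gl (K (E \ s)) (R t)))
      (m2 f hf _) (m2 g hg _)
    have : ∑ t ∈ D.powerset, Z s t = (∑ t ∈ D.powerset, (f (gl (K s) (R t)) - f (gl (K s) (R (D \ t)))) *
          (g (gl (K s) (R t)) - g (gl (K s) (R (D \ t))))) +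
        ∑ t ∈ D.powerset, (f (gl (K (E \ s)) (R t)) - f (gl (K (E \ s)) (R (D \ t)))) *
          (g (gl (K (E \ s)) (R t)) - g (gl (K (E \ s)) (R (D \ t)))) := by
      rw [← Finset.sum_add_distrib]
    rw [this]
    exact add_nonneg hA hB
  -- symmetrise in `t ↦ D ∖ t` and split
  have eJ : ∑ t ∈ D.powerset, ∑ s ∈ S, P s (D \ t) = ∑ t ∈ D.powerset, ∑ s ∈ S, P s t :=
    sum_powerset_sdiff D (fun t => ∑ s ∈ S, P s t)
  have hpair : ∀ t ∈ D.powerset, ∑ s ∈ S, P s t + ∑ s ∈ S, P s (D \ t) = ∑ s ∈ S, Y s t + ∑ s ∈ S, Z s t := by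
    intro t ht
    have ht' := Finset.mem_powerset.mp ht
    rw [← Finset.sum_add_distrib, ← Finset.sum_add_distrib]
    refine Finset.sum_congr rfl fun s _ => ?_
    simp only [hP, hY, hZ, Finset.sdiff_sdiff_eq_self ht']
    ring
  have two : 2 * ∑ t ∈ D.powerset, ∑ s ∈ S, P s t =
      ∑ t ∈ D.powerset, ∑ s ∈ S, Y s t + ∑ t ∈ D.powerset, ∑ s ∈ S, Z s t := by
    rw [two_mul]
    nth_rewrite 2 [← eJ]
    rw [← Finset.sum_add_distrib, ← Finset.sum_add_distrib]
    exact Finset.sum_congr rfl hpair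
  have hYsum : 0 ≤ ∑ t ∈ D.powerset, ∑ s ∈ S, Y s t := Finset.sum_nonneg fun t _ => hYnonneg t
  have hZsum : 0 ≤ ∑ t ∈ D.powerset, ∑ s ∈ S, Z s t := by
    rw [Finset.sum_comm]
    exact Finset.sum_nonneg fun s _ => hZnonneg s
  linarith

end Coefficientwise

end Summit.CriticalPhenomena.PercolationContinuityZ3.Theorems
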